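import Summits.CriticalPhenomena.PercolationContinuityZ3.Theorems.PercNearOneGluingNoHeavyLowerTailOneCutFiveAssembly
import Summits.CriticalPhenomena.PercolationContinuityZ3.Theorems.PercNearOneGluingNoHeavyLowerTailOneCutFiveDownstreamForms
import HarnessLib

/-!
# `NoHeavyLowerTail` (crux stmt-CriticalPhenomena-4575) — the `|A| = 5` CHAIN end to end, in the assembly's vocabulary:
# `X′(5) ∧ CIL₂(5) ⟹ oneCut(5) ⟹ {one-cut, lower tail, linear near-one gluing, the crux's linear form}` for every `A.card ≤ 5`

Joint file of the two `|A| = 5` assembly seats (prim-a5; `--supports stmt-CriticalPhenomena-4575`): assembly-1's typed instances and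
reduction (`OneCutFive.OneCut5`, `OneCutFive.TwoFingerHub`, `OneCutFive.CIL25`, `OneCutFive.oneCut5_of_twoFingerHub_of_cil25`,
`…OneCutFiveAssembly`) composed with assembly-2's downstream package (`OneCutDownstream.*`, `…OneCutFiveDownstream{,LeSix,Forms}`).
No new mathematics; restatements with the named hypotheses, so that a proof of `TwoFingerHub ∧ CIL25` (or of `OneCut5`) closes every
`|A| ≤ 5` consequence by `exact`.  `μ = prodBernoulli w` on `Fin n`, `N = #{a ∈ A : o ↔ a}`, `E N = Σ_{a∈A} μ(o ↔ a)`.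

* `OneCutDownstream.oneCut_card_le_five_of_OneCut5`, `…lowerTail_card_le_five_of_OneCut5`, `…linearGluing_card_le_five_of_OneCut5`,
  `…cruxLinearForm_card_le_five_of_OneCut5` — hypotheses `OneCutFive.OneCut5`;
* `OneCutDownstream.linearGluing_card_le_five_of_twoFingerHub_of_cil25`, `…cruxLinearForm_card_le_five_of_twoFingerHub_of_cil25` —
  hypotheses `OneCutFive.TwoFingerHub`, `OneCutFive.CIL25` (the two census-validated OPEN instances the rung actually needs,
  run/shared/lean/prim/prim-a5/ASSEMBLY.md §5; INEQ-CLAIMS A5-XPRIME / A5-CIL2).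
NOT USED (on purpose, ASSEMBLY.md §1–§4, §8): SHK3⁺, E1, E3GRP — their tree DAG sinks at SHK3⁺.  HONEST LABEL: toward `|A| = 5` of the
one-arm near-critical percolation programme (crux 4575); `OneCut5`, `TwoFingerHub`, `CIL25` are OPEN; nothing here asserts them or the crux.
-/

noncomputable section

namespace Summit.CriticalPhenomena.PercolationContinuityZ3.Theorems

namespace OneCutDownstream

open MeasureTheory Set Literature.Probability.LatticeModels Literature.Probability.Percolation
open scoped Classical BigOperators
open OneCutFive

/-- `OneCut5` ⟹ the one-cut bound for every `A.card ≤ 5` (`oneCut_card_le_five_of_oneCut5` with the named hypothesis). [this work] -/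
theorem oneCut_card_le_five_of_OneCut5 (h5 : OneCut5) :
    ∀ (n : ℕ) (w : Sym2 (Fin n) → unitInterval) (A : Finset (Fin n)) (o : Fin n) (t : ℝ), A.card ≤ 5 → 0 ≤ t →
      (∀ a ∈ A, ∀ a' ∈ A, a ≠ a' → (prodBernoulli w).real (openConn a a')ᶜ ≤ t) →
      (prodBernoulli w).real {ω : BondConfig (Fin n) |
          1 ≤ (A.filter fun a => ω ∈ openConn o a).card ∧
          ((A.filter fun a => ω ∈ openConn o a).card : ℝ) < (∑ a ∈ A, (prodBernoulli w).real (openConn o a)) / 2} ≤ t :=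
  oneCut_card_le_five_of_oneCut5 h5

/-- `OneCut5` ⟹ for `A.card ≤ 5` and `δ ≥ max_{a∈A} μ(a ↮ b)`: `μ{1 ≤ N < E N/2} ≤ 2δ`. [this work] -/
theorem lowerTail_card_le_five_of_OneCut5 (h5 : OneCut5) {n : ℕ} (w : Sym2 (Fin n) → unitInterval) (A : Finset (Fin n))
    (o b : Fin n) (hA : A.card ≤ 5) (δ : ℝ) (hδ : 0 ≤ δ)
    (hAb : ∀ a ∈ A, (prodBernoulli w).real (openConn a b : Set (BondConfig (Fin n)))ᶜ ≤ δ) :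
    (prodBernoulli w).real {ω : BondConfig (Fin n) |
        1 ≤ (A.filter fun a => ω ∈ openConn o a).card ∧
        ((A.filter fun a => ω ∈ openConn o a).card : ℝ) <
          (∑ a ∈ A, (prodBernoulli w).real (openConn o a : Set (BondConfig (Fin n)))) / 2} ≤ 2 * δ :=
  lowerTail_card_le_five_of_oneCut5 h5 w A o b hA δ hδ hAb

/-- `OneCut5` ⟹ for `A.card ≤ 5` and `δ ≥ max_{a∈A} μ(a ↮ b)`: `1 − μ(o ↔ b) ≤ (1 − μ(o ↔ A)) + 4δ`
(linear near-one gluing, `|A|`-free constant 4). [this work] -/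
theorem linearGluing_card_le_five_of_OneCut5 (h5 : OneCut5) {n : ℕ} (w : Sym2 (Fin n) → unitInterval) (A : Finset (Fin n))
    (o b : Fin n) (hA : A.card ≤ 5) (δ : ℝ) (hδ : 0 ≤ δ)
    (hAb : ∀ a ∈ A, (prodBernoulli w).real (openConn a b : Set (BondConfig (Fin n)))ᶜ ≤ δ) :
    1 - (prodBernoulli w).real (openConn o b : Set (BondConfig (Fin n))) ≤
      (1 - (prodBernoulli w).real (⋃ a ∈ A, (openConn o a : Set (BondConfig (Fin n))))) + 4 * δ :=
  linearGluing_card_le_five_of_oneCut5 h5 w A o b hA δ hδ hAb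

/-- `OneCut5` ⟹ the crux's linear lower-tail form (constant `C = 1`) for every `A.card ≤ 5`:
`μ{1 ≤ N < E N/2} ≤ (1 − μ(o ↔ A)) + t` for every `t ≥ 0` bounding the relay–relay cuts. [this work] -/
theorem cruxLinearForm_card_le_five_of_OneCut5 (h5 : OneCut5) {n : ℕ} (w : Sym2 (Fin n) → unitInterval)
    (A : Finset (Fin n)) (o : Fin n) (hA : A.card ≤ 5) (t : ℝ) (ht : 0 ≤ t)
    (hpair : ∀ a ∈ A, ∀ a' ∈ A, a ≠ a' → (prodBernoulli w).real (openConn a a' : Set (BondConfig (Fin n)))ᶜ ≤ t) :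
    (prodBernoulli w).real {ω : BondConfig (Fin n) |
        1 ≤ (A.filter fun a => ω ∈ openConn o a).card ∧
        ((A.filter fun a => ω ∈ openConn o a).card : ℝ) <
          (∑ a ∈ A, (prodBernoulli w).real (openConn o a : Set (BondConfig (Fin n)))) / 2} ≤
      (1 - (prodBernoulli w).real (⋃ a ∈ A, (openConn o a : Set (BondConfig (Fin n))))) + t :=
  cruxLinearForm_card_le_five_of_oneCut5 h5 w A o hA t ht hpair

/-- **The chain from the two OPEN instances the rung needs**: `X′(5)` (hub form) `∧ CIL₂(5)` ⟹ for every `A.card ≤ 5` and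
`δ ≥ max_{a∈A} μ(a ↮ b)`: `1 − μ(o ↔ b) ≤ (1 − μ(o ↔ A)) + 4δ`  (assembly-1's `oneCut5_of_twoFingerHub_of_cil25`, then
`linearGluing_card_le_five_of_oneCut5`). [this work] -/
theorem linearGluing_card_le_five_of_twoFingerHub_of_cil25 (hX : TwoFingerHub) (hC : CIL25) {n : ℕ}
    (w : Sym2 (Fin n) → unitInterval) (A : Finset (Fin n)) (o b : Fin n) (hA : A.card ≤ 5) (δ : ℝ) (hδ : 0 ≤ δ)
    (hAb : ∀ a ∈ A, (prodBernoulli w).real (openConn a b : Set (BondConfig (Fin n)))ᶜ ≤ δ) :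
    1 - (prodBernoulli w).real (openConn o b : Set (BondConfig (Fin n))) ≤
      (1 - (prodBernoulli w).real (⋃ a ∈ A, (openConn o a : Set (BondConfig (Fin n))))) + 4 * δ :=
  linearGluing_card_le_five_of_oneCut5 (oneCut5_of_twoFingerHub_of_cil25 hX hC) w A o b hA δ hδ hAb

/-- **The chain to the crux's linear form**: `X′(5) ∧ CIL₂(5)` ⟹ for every `A.card ≤ 5` and `t ≥` the relay–relay cuts,
`μ{1 ≤ N < E N/2} ≤ (1 − μ(o ↔ A)) + t` (and, sharper, `≤ t`: `oneCut_card_le_five_of_OneCut5`). [this work] -/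
theorem cruxLinearForm_card_le_five_of_twoFingerHub_of_cil25 (hX : TwoFingerHub) (hC : CIL25) {n : ℕ}
    (w : Sym2 (Fin n) → unitInterval) (A : Finset (Fin n)) (o : Fin n) (hA : A.card ≤ 5) (t : ℝ) (ht : 0 ≤ t)
    (hpair : ∀ a ∈ A, ∀ a' ∈ A, a ≠ a' → (prodBernoulli w).real (openConn a a' : Set (BondConfig (Fin n)))ᶜ ≤ t) :
    (prodBernoulli w).real {ω : BondConfig (Fin n) |
        1 ≤ (A.filter fun a => ω ∈ openConn o a).card ∧
        ((A.filter fun a => ω ∈ openConn o a).card : ℝ) <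
          (∑ a ∈ A, (prodBernoulli w).real (openConn o a : Set (BondConfig (Fin n)))) / 2} ≤
      (1 - (prodBernoulli w).real (⋃ a ∈ A, (openConn o a : Set (BondConfig (Fin n))))) + t :=
  cruxLinearForm_card_le_five_of_oneCut5 (oneCut5_of_twoFingerHub_of_cil25 hX hC) w A o hA t ht hpair

end OneCutDownstream

end Summit.CriticalPhenomena.PercolationContinuityZ3.Theorems

end
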